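import Summits.Ventures.DiscreteObjects.Hadamard.Order25FixedNotThree668
import Mathlib.LinearAlgebra.Matrix.Rank

/-!
# Hadamard 668 census, family F12 — the FIXED GRAM MATRIX mod `p`: a signed automorphism of prime-power exponent
# fixes as many rows as columns, and `(#Fix)^(#Fix)` is a square mod `p` (kernel, general tool)

Framing: lottery ticket; floor = certified bounds/negative ranges.

Cell pub-namedobj (venture DiscreteObjects), target (H), hadamard gen 18.  Gen 17's (E3) lemma `fixedRows_inner_dvd`
says: for a signed automorphism `(π, κ, d, e)` of a Hadamard matrix with `κ^(p·p) = 1`, two distinct `π`-fixed rows of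
equal sign have inner product `≡ 0 (mod p)` ON THE `κ`-FIXED COLUMNS.  Read as a statement about the fixed submatrix
`F = H[Fix π, Fix κ]` over `ZMod p` it is `F Fᵀ = |Fix κ| • 1` (and dually `Fᵀ F = |Fix π| • 1`), whence by linear
algebra over the field `ZMod p`:
* `card_le_of_mul_transpose_eq_smul` (any field): `A Aᵀ = c • 1` with `c ≠ 0` forces `#rows ≤ #cols` (rank);
  `det_sq_of_mul_transpose_eq_smul`: for square `A`, `(det A)² = c ^ #rows`.
* `card_le_card_of_inner_dvd`, `isSquare_pow_of_inner_dvd`: the `±1`-block version over `ℤ` — for finite sets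
  `R, C` and a `±1`-valued `F` on `R × C` whose distinct rows have inner products over `C` divisible by `p`:
  `p ∤ |C| ⇒ |R| ≤ |C|`, and `|R| = |C| ⇒ (|C| : ZMod p)^|R|` is a square.
* **`signedAut_card_fixed_eq`**: for a signed automorphism of a Hadamard matrix with `π^(p·p) = κ^(p·p) = 1` and
  `p ∤ #Fix π`, `p ∤ #Fix κ`: **`#Fix π = #Fix κ`** and **`((#Fix κ : ZMod p))^(#Fix π)` is a square in `ZMod p`**.
  (For `p`-power exponent and `p ∤ n` the non-divisibility is automatic: `#Fix ≡ n (mod p)`.)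
* APPLICATIONS at order `668` (structure of a hypothetical object; no order excluded here):
  `hadamard668_order25_fixed_eq` — pair-order `25` ⇒ `#Fix π = #Fix κ ∈ {8, 18}` (gen 17 left `{8, 13, 18, 23}` on
  each side separately; `13` and `23` die because `3^13 = 3` and `3^23 = 2` are non-squares mod `5`);
  `hadamard668_order9_fixed_eq` — pair-order `9` ⇒ `#Fix π = #Fix κ`, EVEN, `≡ 2 (mod 6)`, `≤ 74` (odd `f ≡ 2 (mod 3)`
  dies because `2^f = 2` is a non-square mod `3`).
Ours, not literature (the rank/determinant reading of the fixed submatrix is folklore in the coding-theoretic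
literature on automorphisms of designs, cf. Lander 1983 ch. 3 / Tonchev; no published statement is used); no `sorry`,
no definitions, default heartbeats.
-/

namespace Summit.Ventures.DiscreteObjects.Hadamard

open Finset BigOperators Matrix

open Literature.Combinatorics.Designs.GoethalsSeidel (IsHadamardMatrix)

section field
variable {K : Type*} [Field K] {m n : Type*} [Fintype m] [Fintype n] [DecidableEq m]

/-- **rank**: if `A Aᵀ = c • 1` with `c ≠ 0` over a field then `A` has at least as many columns as rows. -/
theorem card_le_of_mul_transpose_eq_smul (A : Matrix m n K) {c : K} (hc : c ≠ 0)
    (h : A * Aᵀ = c • (1 : Matrix m m K)) : Fintype.card m ≤ Fintype.card n := by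
  have hu : IsUnit (A * Aᵀ) := by
    rw [h, Matrix.isUnit_iff_isUnit_det, Matrix.det_smul, Matrix.det_one, mul_one]
    exact (isUnit_iff_ne_zero.mpr hc).pow _
  calc Fintype.card m = (A * Aᵀ).rank := (Matrix.rank_of_isUnit _ hu).symm
    _ ≤ A.rank := Matrix.rank_mul_le_left _ _
    _ ≤ Fintype.card n := Matrix.rank_le_card_width _

omit [Fintype n] in
/-- **determinant**: if `A Aᵀ = c • 1` for a square `A` then `(det A)² = c ^ #rows`. -/
theorem det_sq_of_mul_transpose_eq_smul (A : Matrix m m K) {c : K} (h : A * Aᵀ = c • (1 : Matrix m m K)) :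
    A.det ^ 2 = c ^ Fintype.card m := by
  have e := congrArg Matrix.det h
  rw [Matrix.det_mul, Matrix.det_transpose, Matrix.det_smul, Matrix.det_one, mul_one] at e
  rw [sq]; exact e

end field

section block
variable {ι : Type*} [DecidableEq ι]

/-- the mod-`p` Gram entries of a `±1` block whose distinct rows have inner products `≡ 0 (mod p)` -/
lemma gram_modp_entry {p : ℕ} (F : ι → ι → ℤ) (R C : Finset ι)
    (hpm : ∀ x ∈ R, ∀ y ∈ C, F x y = 1 ∨ F x y = -1)
    (hrow : ∀ x ∈ R, ∀ x' ∈ R, x ≠ x' → (p : ℤ) ∣ ∑ y ∈ C, F x y * F x' y) (x x' : R) :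
    ∑ y : C, ((F x y : ℤ) : ZMod p) * ((F x' y : ℤ) : ZMod p) =
      if x = x' then ((C.card : ℕ) : ZMod p) else 0 := by
  have hcast : ∑ y : C, ((F x y : ℤ) : ZMod p) * ((F x' y : ℤ) : ZMod p) =
      (((∑ y ∈ C, F x y * F x' y : ℤ)) : ZMod p) := by
    push_cast
    exact Finset.sum_coe_sort C (fun y => ((F x y : ℤ) : ZMod p) * ((F x' y : ℤ) : ZMod p))
  rw [hcast]
  split_ifs with hxx
  · subst hxx
    have h1 : ∀ y ∈ C, F x y * F x y = 1 := fun y hy => pm_mul_self (hpm x x.2 y hy)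
    rw [Finset.sum_congr rfl h1, Finset.sum_const, nsmul_eq_mul, mul_one]
    exact Int.cast_natCast _
  · have hne : (x : ι) ≠ x' := fun h => hxx (Subtype.ext h)
    exact (ZMod.intCast_zmod_eq_zero_iff_dvd _ _).mpr (hrow x x.2 x' x'.2 hne)

/-- **`p ∤ |C| ⇒ |R| ≤ |C|`** for a `±1` block on `R × C` whose distinct rows have inner products over `C` divisible
by the prime `p`. -/
theorem card_le_card_of_inner_dvd {p : ℕ} (hp : p.Prime) (F : ι → ι → ℤ) (R C : Finset ι)
    (hpm : ∀ x ∈ R, ∀ y ∈ C, F x y = 1 ∨ F x y = -1)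
    (hrow : ∀ x ∈ R, ∀ x' ∈ R, x ≠ x' → (p : ℤ) ∣ ∑ y ∈ C, F x y * F x' y)
    (hC : ¬ p ∣ C.card) : R.card ≤ C.card := by
  haveI : Fact p.Prime := ⟨hp⟩
  set A : Matrix R C (ZMod p) := Matrix.of fun x y => ((F x y : ℤ) : ZMod p) with hA
  have hG : A * Aᵀ = ((C.card : ℕ) : ZMod p) • (1 : Matrix R R (ZMod p)) := by
    ext x x'
    rw [Matrix.mul_apply, Matrix.smul_apply, Matrix.one_apply]
    simp only [hA, Matrix.transpose_apply, Matrix.of_apply]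
    rw [gram_modp_entry F R C hpm hrow x x']
    split_ifs <;> simp
  have hc : ((C.card : ℕ) : ZMod p) ≠ 0 := fun h => hC ((ZMod.natCast_eq_zero_iff _ _).mp h)
  have := card_le_of_mul_transpose_eq_smul A hc hG
  rwa [Fintype.card_coe, Fintype.card_coe] at this

/-- **`|R| = |C| ⇒ (|C|)^|R|` is a square mod `p`** (the determinant of the reindexed square block). -/
theorem isSquare_pow_of_inner_dvd {p : ℕ} (F : ι → ι → ℤ) (R C : Finset ι)
    (hpm : ∀ x ∈ R, ∀ y ∈ C, F x y = 1 ∨ F x y = -1)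
    (hrow : ∀ x ∈ R, ∀ x' ∈ R, x ≠ x' → (p : ℤ) ∣ ∑ y ∈ C, F x y * F x' y)
    (hRC : R.card = C.card) : IsSquare ((((C.card : ℕ) : ZMod p)) ^ R.card) := by
  have hcardRC : Fintype.card R = Fintype.card C := by rw [Fintype.card_coe, Fintype.card_coe, hRC]
  obtain ⟨eRC⟩ : Nonempty (R ≃ C) := Fintype.card_eq.mp hcardRC
  set B : Matrix R R (ZMod p) := Matrix.of fun x x' => ((F x (eRC x') : ℤ) : ZMod p) with hB
  have hG : B * Bᵀ = ((C.card : ℕ) : ZMod p) • (1 : Matrix R R (ZMod p)) := by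
    ext x x'
    rw [Matrix.mul_apply, Matrix.smul_apply, Matrix.one_apply]
    simp only [hB, Matrix.transpose_apply, Matrix.of_apply]
    rw [Equiv.sum_comp eRC (fun y : C => ((F x y : ℤ) : ZMod p) * ((F x' y : ℤ) : ZMod p)),
      gram_modp_entry F R C hpm hrow x x']
    split_ifs <;> simp
  have e := congrArg Matrix.det hG
  rw [Matrix.det_mul, Matrix.det_transpose, Matrix.det_smul, Matrix.det_one, mul_one, Fintype.card_coe] at e
  exact ⟨B.det, e.symm⟩

end block

section signedAut
variable {ι : Type*} [Fintype ι] [DecidableEq ι]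
variable {H : Matrix ι ι ℤ} {π κ : Equiv.Perm ι} {d e : ι → ℤ}

/-- (E3) for all pairs at once: with `κ^(p·p) = 1` and at least one `κ`-fixed column, distinct `π`-fixed rows have
inner products over the `κ`-fixed columns divisible by `p`. -/
theorem signedAut_fixedRows_inner_dvd (hH : IsHadamardMatrix H) (haut : IsSignedAut H π κ d e) {p : ℕ}
    (hp : p.Prime) (hκ : κ ^ (p * p) = 1) (hC : 0 < (univ.filter fun j => κ j = j).card) :
    ∀ x ∈ univ.filter (fun i => π i = i), ∀ x' ∈ univ.filter (fun i => π i = i), x ≠ x' →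
      (p : ℤ) ∣ ∑ y ∈ univ.filter (fun j => κ j = j), H x y * H x' y := by
  obtain ⟨j₀, hj₀⟩ := Finset.card_pos.mp hC
  simp only [Finset.mem_filter, Finset.mem_univ, true_and] at hj₀
  intro x hx x' hx' hxx'
  simp only [Finset.mem_filter, Finset.mem_univ, true_and] at hx hx'
  have hdd : d x = d x' := by
    rw [signedAut_fixed_sign hH.1 haut hx hj₀, signedAut_fixed_sign hH.1 haut hx' hj₀]
  exact fixedRows_inner_dvd hH haut hp hκ hxx' hx hx' hdd

/-- **A signed automorphism of exponent `p²` with `p ∤ #Fix π`, `p ∤ #Fix κ` fixes as many rows as columns, and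
`(#Fix κ)^(#Fix π)` is a square mod `p`.** -/
theorem signedAut_card_fixed_eq (hH : IsHadamardMatrix H) (haut : IsSignedAut H π κ d e) {p : ℕ} (hp : p.Prime)
    (hπ : π ^ (p * p) = 1) (hκ : κ ^ (p * p) = 1)
    (hR : ¬ p ∣ (univ.filter fun i => π i = i).card) (hC : ¬ p ∣ (univ.filter fun j => κ j = j).card) :
    (univ.filter fun i => π i = i).card = (univ.filter fun j => κ j = j).card ∧
      IsSquare ((((univ.filter fun j => κ j = j).card : ℕ) : ZMod p) ^ (univ.filter fun i => π i = i).card) := by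
  have hRpos : 0 < (univ.filter fun i => π i = i).card := by
    rcases Nat.eq_zero_or_pos (univ.filter fun i => π i = i).card with h | h
    · rw [h] at hR; exact absurd (dvd_zero p) hR
    · exact h
  have hCpos : 0 < (univ.filter fun j => κ j = j).card := by
    rcases Nat.eq_zero_or_pos (univ.filter fun j => κ j = j).card with h | h
    · rw [h] at hC; exact absurd (dvd_zero p) hC
    · exact h
  have hcard : (Fintype.card ι : ℤ) ≠ 0 := by
    have : 0 < Fintype.card ι := lt_of_lt_of_le hRpos (Finset.card_le_univ _)
    exact_mod_cast this.ne'
  have hHt : IsHadamardMatrix Hᵀ := isHadamard_transpose hH hcard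
  have hautT : IsSignedAut Hᵀ κ π e d := isSignedAut_transpose haut
  have hrows := signedAut_fixedRows_inner_dvd hH haut hp hκ hCpos
  have hcols := signedAut_fixedRows_inner_dvd hHt hautT hp hπ hRpos
  have hpmR : ∀ x ∈ univ.filter (fun i => π i = i), ∀ y ∈ univ.filter (fun j => κ j = j),
      H x y = 1 ∨ H x y = -1 := fun x _ y _ => hH.1 x y
  have hpmC : ∀ y ∈ univ.filter (fun j => κ j = j), ∀ x ∈ univ.filter (fun i => π i = i),
      Hᵀ y x = 1 ∨ Hᵀ y x = -1 := fun y _ x _ => hH.1 x y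
  have h1 := card_le_card_of_inner_dvd hp (fun x y => H x y) _ _ hpmR hrows hC
  have h2 := card_le_card_of_inner_dvd hp (fun y x => Hᵀ y x) _ _ hpmC hcols hR
  have heq : (univ.filter fun i => π i = i).card = (univ.filter fun j => κ j = j).card := le_antisymm h1 h2
  exact ⟨heq, isSquare_pow_of_inner_dvd (fun x y => H x y) _ _ hpmR hrows heq⟩

/-- **Order 25 at 668: `#Fix π = #Fix κ ∈ {8, 18}`.**  For a signed automorphism of an H(668) with
`π^25 = κ^25 = 1`, `(π⁵, κ⁵) ≠ (1, 1)`.  [Gen 17: each count lies in `{8, 13, 18, 23}`; `signedAut_card_fixed_eq`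
makes them equal and `13`, `23` would make `3^13 = 3`, `3^23 = 2` squares mod `5`.]  Structure only. -/
theorem hadamard668_order25_fixed_eq (hH : IsHadamardMatrix H) (hι : Fintype.card ι = 668)
    (π κ : Equiv.Perm ι) (d e : ι → ℤ) (haut : IsSignedAut H π κ d e)
    (hπ : π ^ 25 = 1) (hκ : κ ^ 25 = 1) (hne : π ^ 5 ≠ 1 ∨ κ ^ 5 ≠ 1) :
    (univ.filter fun i => π i = i).card = (univ.filter fun j => κ j = j).card ∧
    ((univ.filter fun j => κ j = j).card = 8 ∨ (univ.filter fun j => κ j = j).card = 18) := by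
  obtain ⟨hR, hC⟩ := hadamard668_order25_fixed hH hι π κ d e haut hπ hκ hne
  have hR5 : ¬ 5 ∣ (univ.filter fun i => π i = i).card := by omega
  have hC5 : ¬ 5 ∣ (univ.filter fun j => κ j = j).card := by omega
  obtain ⟨heq, hsq⟩ := signedAut_card_fixed_eq hH haut (by norm_num : (5 : ℕ).Prime) hπ hκ hR5 hC5
  refine ⟨heq, ?_⟩
  rw [heq] at hsq
  rcases hC with h | h | h | h
  · exact Or.inl h
  · exfalso; rw [h] at hsq; revert hsq; decide
  · exact Or.inr h
  · exfalso; rw [h] at hsq; revert hsq; decide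

/-- odd powers of `2` are not squares mod `3` -/
lemma not_isSquare_two_pow_odd_mod3 {f : ℕ} (hf : f % 2 = 1) : ¬ IsSquare ((2 : ZMod 3) ^ f) := by
  have h2 : (2 : ZMod 3) ^ f = 2 := by
    obtain ⟨k, rfl⟩ : ∃ k, f = 2 * k + 1 := ⟨f / 2, by omega⟩
    rw [pow_succ, pow_mul]
    have : (2 : ZMod 3) ^ 2 = 1 := by decide
    rw [this, one_pow, one_mul]
  rw [h2]; decide

/-- **Order 9 at 668: `#Fix π = #Fix κ`, even, `≡ 2 (mod 6)`, `≤ 74`.**  For a signed automorphism of an H(668) with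
`π^9 = κ^9 = 1`, `(π³, κ³) ≠ (1, 1)`.  [Gen 17: each count is `≡ 2 (mod 3)` and `≤ 74`; `signedAut_card_fixed_eq`
makes them equal and an odd count `f` would make `2^f = 2` a square mod `3`.]  Structure only. -/
theorem hadamard668_order9_fixed_eq (hH : IsHadamardMatrix H) (hι : Fintype.card ι = 668)
    (π κ : Equiv.Perm ι) (d e : ι → ℤ) (haut : IsSignedAut H π κ d e)
    (hπ : π ^ 9 = 1) (hκ : κ ^ 9 = 1) (hne : π ^ 3 ≠ 1 ∨ κ ^ 3 ≠ 1) :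
    (univ.filter fun i => π i = i).card = (univ.filter fun j => κ j = j).card ∧
    (univ.filter fun j => κ j = j).card % 6 = 2 ∧ (univ.filter fun j => κ j = j).card ≤ 74 := by
  obtain ⟨⟨-, -, -, hR74, hR3, -⟩, ⟨-, -, -, hC74, hC3, -⟩⟩ :=
    hadamard668_order9_structure hH hι π κ d e haut hπ hκ hne
  have hR' : ¬ 3 ∣ (univ.filter fun i => π i = i).card := by omega
  have hC' : ¬ 3 ∣ (univ.filter fun j => κ j = j).card := by omega
  obtain ⟨heq, hsq⟩ := signedAut_card_fixed_eq hH haut (by norm_num : (3 : ℕ).Prime) hπ hκ hR' hC'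
  refine ⟨heq, ?_, hC74⟩
  rw [heq] at hsq
  set f := (univ.filter fun j => κ j = j).card with hf
  have hcast : ((f : ℕ) : ZMod 3) = 2 := by
    have : ((f : ℕ) : ZMod 3) = ((f % 3 : ℕ) : ZMod 3) := by rw [ZMod.natCast_mod]
    rw [this, hC3]; rfl
  rw [hcast] at hsq
  by_contra hodd
  have hodd' : f % 2 = 1 := by omega
  exact not_isSquare_two_pow_odd_mod3 hodd' hsq

end signedAut

end Summit.Ventures.DiscreteObjects.Hadamard
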